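import Literature.NumberTheory.DiophantineGeometry.AbcWave0QualityFormProofs
import Summits.ABC.ABC.Theorems.RibetTakahashiSplitFewPrimeValuationProductStubDecisivePrimeBootstrapLemmas
import HarnessLib

/-!
# Line `matveev-face-clearing` for crux `FewPrimeValuationProduct` (stmt-ABC-1563): the glue, part 1

Support file (`--supports stmt-ABC-1563`) for the crux `Summit.ABC.ABC.Theses.RibetTakahashiSplit.FewPrimeValuationProduct`
(route `RibetTakahashiSplit`, r4: `T(E) := ∏_{p ∥ N} ord_p Δ_min ≤ C_ε N^ε` for `E/ℚ` semistable away from `2` with `≤ 3` odd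
multiplicative primes). It is the sorry-free glue of the line's skeleton (planner
`Cruxes/FewPrimeValuationProduct/Lines/matveev_face_clearing.lean`, namespace `…Cruxes.…MatveevFaceClearing`, not importable from
`Theorems/`), re-homed verbatim under `Summit.ABC.ABC.Theorems.FewPrimeValuationProduct` so that the conditional compositions of
`…OfParts.lean` are citable theorems:

* `face_rpow_of_polylog` (with `decisivePrimeBootstrap_polylog_le_rpow`: `max(log R, 1)^m ≤ D_ε R^ε`) — the face dividend `log c ≤ κ (log rad)^A` turns into `∏_{p∣abc} v_p(abc) ≤ C_ε rad^ε`;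
* `frey_of_parts` — face / small-prime / balanced trichotomy: the three cell bounds give `∏ v_p ≤ K_ε rad^ε` for every abc triple on
  `≤ 4` primes (registered sub-goal `frey_of_parts`).

References: H. Pasten, Invent. Math. 236 (2024) (the LFL input behind the cells); C. L. Stewart, K. Yu, Duke Math. J. 108 (2001).
-/

-- `Summit.<Summit>.<Problem>`: for the single-conjunct summit `ABC` the duplicate `ABC.ABC` is mandated.
set_option linter.dupNamespace false

noncomputable section

namespace Summit.ABC.ABC.Theorems.FewPrimeValuationProduct

open scoped BigOperators
open Finset
open Literature.NumberTheory.DiophantineGeometry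

/-! ## Glue, part 1 (sorry-free): polylog ⟹ `rad^ε`, and the face / small-prime / balanced trichotomy -/

/-- Every exponent of `n ≠ 0` is at most `log n / log 2`. [folklore] -/
theorem factorization_le_log {n p : ℕ} (hn : n ≠ 0) (hp : p ∈ n.primeFactors) :
    ((n.factorization p : ℕ) : ℝ) ≤ Real.log n / Real.log 2 := by
  have hpp : p.Prime := Nat.prime_of_mem_primeFactors hp
  have h2p : (2 : ℝ) ≤ p := by exact_mod_cast hpp.two_le
  have hlog2 : 0 < Real.log 2 := Real.log_pos one_lt_two
  have hlogp : Real.log 2 ≤ Real.log p := Real.log_le_log two_pos h2p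
  have hppos : (0 : ℝ) < p := by linarith
  have hle : p ^ n.factorization p ≤ n := Nat.ordProj_le p hn
  have hle' : (p : ℝ) ^ n.factorization p ≤ n := by exact_mod_cast hle
  have hlog := Real.log_le_log (pow_pos hppos _) hle'
  rw [Real.log_pow] at hlog
  rw [le_div_iff₀ hlog2]
  calc ((n.factorization p : ℕ) : ℝ) * Real.log 2
      ≤ ((n.factorization p : ℕ) : ℝ) * Real.log p :=
        mul_le_mul_of_nonneg_left hlogp (Nat.cast_nonneg _)
    _ ≤ Real.log n := hlog

/-- With `≤ 4` prime factors, `∏_{p ∣ n} v_p(n) ≤ max(log n / log 2, 1)⁴`. [folklore] -/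
theorem prod_factorization_le {n : ℕ} (hn : n ≠ 0) (hcard : n.primeFactors.card ≤ 4) :
    ((∏ p ∈ n.primeFactors, n.factorization p : ℕ) : ℝ) ≤ (max (Real.log n / Real.log 2) 1) ^ 4 := by
  rw [Nat.cast_prod]
  have h1 : (1 : ℝ) ≤ max (Real.log n / Real.log 2) 1 := le_max_right _ _
  calc ∏ p ∈ n.primeFactors, ((n.factorization p : ℕ) : ℝ)
      ≤ ∏ _p ∈ n.primeFactors, max (Real.log n / Real.log 2) 1 := by
        apply Finset.prod_le_prod (fun p _ => Nat.cast_nonneg _)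
        intro p hp
        exact (factorization_le_log hn hp).trans (le_max_left _ _)
    _ = (max (Real.log n / Real.log 2) 1) ^ n.primeFactors.card := Finset.prod_const _
    _ ≤ (max (Real.log n / Real.log 2) 1) ^ 4 := pow_le_pow_right₀ h1 hcard

/-- **Faces: polylog ⟹ `rad^ε`.** From the conclusion of `stub_faceBound` (`log c ≤ κ (log rad)^A` on the
power-of-two faces) the valuation product of a face triple is `≤ C_ε rad^ε` for every `ε > 0`:
`∏ v_p ≤ (3 log c / log 2)⁴ ≤ (3κ/log 2)⁴ (log rad)^{4A} ≤ C_ε rad^ε`. [folklore] -/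
theorem face_rpow_of_polylog
    (h2 : ∃ (A : ℕ) (κ : ℝ), ∀ a b c : ℕ, IsABCTriple a b c → (a * b * c).primeFactors.card ≤ 4 →
      ((∃ j : ℕ, a = 2 ^ j) ∨ (∃ j : ℕ, b = 2 ^ j) ∨ (∃ j : ℕ, c = 2 ^ j)) →
      Real.log c ≤ κ * Real.log (rad a b c : ℝ) ^ A) :
    ∀ ε : ℝ, 0 < ε → ∃ C : ℝ, ∀ a b c : ℕ, IsABCTriple a b c → (a * b * c).primeFactors.card ≤ 4 →
      ((∃ j : ℕ, a = 2 ^ j) ∨ (∃ j : ℕ, b = 2 ^ j) ∨ (∃ j : ℕ, c = 2 ^ j)) →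
      ((∏ p ∈ (a * b * c).primeFactors, (a * b * c).factorization p : ℕ) : ℝ) ≤
        C * (rad a b c : ℝ) ^ ε := by
  obtain ⟨A, κ, h⟩ := h2
  intro ε hε
  obtain ⟨D, hD0, hD⟩ := decisivePrimeBootstrap_polylog_le_rpow (4 * A) hε
  set κ' : ℝ := max κ 1 with hκ'
  have hκ'1 : 1 ≤ κ' := le_max_right _ _
  have hκ'0 : 0 ≤ κ' := zero_le_one.trans hκ'1
  have hlog2 : 0 < Real.log 2 := Real.log_pos one_lt_two
  have hlog2' : Real.log 2 < 1 := by
    have := Real.log_two_lt_d9; linarith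
  refine ⟨(3 * κ' / Real.log 2) ^ 4 * D, ?_⟩
  intro a b c habc hcard hface
  have hlogc := h a b c habc hcard hface
  have hrad2 : 2 ≤ rad a b c := habc.two_le_rad
  have hc2 : 2 ≤ c := habc.two_le
  obtain ⟨ha, hb, hsum, hcop⟩ := habc
  have hc : 0 < c := by omega
  have hn0 : a * b * c ≠ 0 := by positivity
  -- notation
  set n : ℕ := a * b * c with hn
  set L : ℝ := Real.log (rad a b c : ℝ) with hL
  set M : ℝ := Real.log n / Real.log 2 with hM
  have hrad1 : (1 : ℝ) ≤ (rad a b c : ℝ) := by exact_mod_cast (le_trans (by norm_num) hrad2)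
  have hL0 : 0 ≤ L := Real.log_nonneg hrad1
  have hLA : 0 ≤ L ^ A := pow_nonneg hL0 A
  have hmax1 : 1 ≤ max L 1 := le_max_right _ _
  have hmaxA : 1 ≤ (max L 1) ^ A := one_le_pow₀ hmax1
  -- log n ≤ 3 log c
  have hcR : (0 : ℝ) < c := by exact_mod_cast hc
  have hnle : (n : ℝ) ≤ (c : ℝ) ^ 3 := by
    have hac : a ≤ c := by omega
    have hbc : b ≤ c := by omega
    have : a * b * c ≤ c ^ 3 := by
      calc a * b * c ≤ c * c * c := by gcongr
        _ = c ^ 3 := by ring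
    rw [← hn] at this
    exact_mod_cast this
  have hnpos : (0 : ℝ) < n := by exact_mod_cast Nat.pos_of_ne_zero hn0
  have hlogn : Real.log n ≤ 3 * Real.log c := by
    have := Real.log_le_log hnpos hnle
    rwa [Real.log_pow, Nat.cast_ofNat] at this
  -- log c ≤ κ' (max L 1)^A
  have hlogc' : Real.log c ≤ κ' * (max L 1) ^ A := by
    calc Real.log c ≤ κ * L ^ A := hlogc
      _ ≤ κ' * L ^ A := mul_le_mul_of_nonneg_right (le_max_left _ _) hLA
      _ ≤ κ' * (max L 1) ^ A :=
          mul_le_mul_of_nonneg_left (pow_le_pow_left₀ hL0 (le_max_left _ _) A) hκ'0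
  -- M ≤ Q := 3 κ' (max L 1)^A / log 2, and Q ≥ 1
  set Q : ℝ := 3 * κ' / Real.log 2 * (max L 1) ^ A with hQ
  have hQ1 : 1 ≤ Q := by
    have h3 : 1 ≤ 3 * κ' / Real.log 2 := by
      rw [le_div_iff₀ hlog2]; linarith
    exact one_le_mul_of_one_le_of_one_le h3 hmaxA
  have hMQ : M ≤ Q := by
    rw [hM, div_le_iff₀ hlog2]
    calc Real.log n ≤ 3 * Real.log c := hlogn
      _ ≤ 3 * (κ' * (max L 1) ^ A) := by linarith
      _ = 3 * κ' / Real.log 2 * (max L 1) ^ A * Real.log 2 := by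
          field_simp
  have hmaxMQ : max M 1 ≤ Q := max_le hMQ hQ1
  have hmaxM0 : 0 ≤ max M 1 := zero_le_one.trans (le_max_right _ _)
  -- the chain
  have hP : ((∏ p ∈ n.primeFactors, n.factorization p : ℕ) : ℝ) ≤ (max M 1) ^ 4 :=
    prod_factorization_le hn0 hcard
  have hpoly : (max L 1) ^ (4 * A) ≤ D * (rad a b c : ℝ) ^ ε := hD _ hrad1
  have hK0 : 0 ≤ (3 * κ' / Real.log 2) ^ 4 := by positivity
  calc ((∏ p ∈ n.primeFactors, n.factorization p : ℕ) : ℝ) ≤ (max M 1) ^ 4 := hP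
    _ ≤ Q ^ 4 := pow_le_pow_left₀ hmaxM0 hmaxMQ 4
    _ = (3 * κ' / Real.log 2) ^ 4 * (max L 1) ^ (4 * A) := by
        rw [hQ, mul_pow, ← pow_mul, mul_comm A 4]
    _ ≤ (3 * κ' / Real.log 2) ^ 4 * (D * (rad a b c : ℝ) ^ ε) :=
        mul_le_mul_of_nonneg_left hpoly hK0
    _ = (3 * κ' / Real.log 2) ^ 4 * D * (rad a b c : ℝ) ^ ε := by ring

/-- **The Frey part of the crux from stubs 2–4** (their conclusions as hypotheses): for every `ε > 0` there is
`K` with `∏_{p ∣ abc} v_p(abc) ≤ K · rad^ε` for every abc triple supported on `≤ 4` primes — the trichotomy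
face / (non-face, some odd prime `≤ rad^{ε/5}`) / (non-face, all odd primes `> rad^{ε/5}`). [folklore] -/
theorem frey_of_parts :
    (∀ ε : ℝ, 0 < ε → ∃ C : ℝ, ∀ a b c : ℕ, Literature.NumberTheory.DiophantineGeometry.IsABCTriple a b c → (a * b * c).primeFactors.card ≤ 4 → ((∃ j : ℕ, a = 2 ^ j) ∨ (∃ j : ℕ, b = 2 ^ j) ∨ (∃ j : ℕ, c = 2 ^ j)) → ((∏ p ∈ (a * b * c).primeFactors, (a * b * c).factorization p : ℕ) : ℝ) ≤ C * (Literature.NumberTheory.DiophantineGeometry.rad a b c : ℝ) ^ ε) → (∀ ε : ℝ, 0 < ε → ∃ C : ℝ, ∀ a b c : ℕ, Literature.NumberTheory.DiophantineGeometry.IsABCTriple a b c → (a * b * c).primeFactors.card ≤ 4 → ¬ ((∃ j : ℕ, a = 2 ^ j) ∨ (∃ j : ℕ, b = 2 ^ j) ∨ (∃ j : ℕ, c = 2 ^ j)) → (∃ p ∈ (a * b * c).primeFactors, p ≠ 2 ∧ (p : ℝ) ≤ (Literature.NumberTheory.DiophantineGeometry.rad a b c : ℝ) ^ ε) → ((∏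 p ∈ (a * b * c).primeFactors, (a * b * c).factorization p : ℕ) : ℝ) ≤ C * (Literature.NumberTheory.DiophantineGeometry.rad a b c : ℝ) ^ (5 * ε)) → (∀ ε : ℝ, 0 < ε → ∃ C : ℝ, ∀ a b c : ℕ, Literature.NumberTheory.DiophantineGeometry.IsABCTriple a b c → (a * b * c).primeFactors.card ≤ 4 → ¬ ((∃ j : ℕ, a = 2 ^ j) ∨ (∃ j : ℕ, b = 2 ^ j) ∨ (∃ j : ℕ, c = 2 ^ j)) → (∀ p ∈ (a * b * c).primeFactors, p ≠ 2 → (Literature.NumberTheory.DiophantineGeometry.rad a b c : ℝ) ^ ε < p) → ((∏ p ∈ (a * b * c).primeFactors, (a * b * c).factorization p : ℕ) : ℝ) ≤ C * (Literature.NumberTheory.DiophantineGeometry.rad a b c : ℝ) ^ ε) → ∀ ε : ℝ, 0 < ε → ∃ K : ℝ, ∀ a b c : ℕ, Literature.NumberTheory.DiophantineGeometry.IsABCTriple a b c → (a * b * c).primeFactors.card ≤ 4 → ((∏ p ∈ (a * b * c).primeFactors, (a * b * c).factorization p : ℕ) : ℝ) ≤ K * (Literature.NumberTheory.DiophantineGeometry.rad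 a b c : ℝ) ^ ε := by
  intro hface hsmall hbal ε hε
  have hε5 : 0 < ε / 5 := by positivity
  obtain ⟨C₁, hC₁⟩ := hface ε hε
  obtain ⟨C₂, hC₂⟩ := hsmall (ε / 5) hε5
  obtain ⟨C₃, hC₃⟩ := hbal (ε / 5) hε5
  refine ⟨max (max C₁ C₂) (max C₃ 0), ?_⟩
  intro a b c habc hcard
  have hrad1 : (1 : ℝ) ≤ (rad a b c : ℝ) := by
    exact_mod_cast (le_trans (by norm_num) habc.two_le_rad)
  have hrε : 0 ≤ (rad a b c : ℝ) ^ ε := Real.rpow_nonneg (zero_le_one.trans hrad1) ε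
  have hK1 : C₁ ≤ max (max C₁ C₂) (max C₃ 0) := (le_max_left _ _).trans (le_max_left _ _)
  have hK2 : C₂ ≤ max (max C₁ C₂) (max C₃ 0) := (le_max_right _ _).trans (le_max_left _ _)
  have hK3 : C₃ ≤ max (max C₁ C₂) (max C₃ 0) := (le_max_left _ _).trans (le_max_right _ _)
  have hK0 : 0 ≤ max (max C₁ C₂) (max C₃ 0) := (le_max_right _ _).trans (le_max_right _ _)
  by_cases hf : (∃ j : ℕ, a = 2 ^ j) ∨ (∃ j : ℕ, b = 2 ^ j) ∨ (∃ j : ℕ, c = 2 ^ j)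
  · exact (hC₁ a b c habc hcard hf).trans (mul_le_mul_of_nonneg_right hK1 hrε)
  · by_cases hs : ∃ p ∈ (a * b * c).primeFactors, p ≠ 2 ∧ (p : ℝ) ≤ (rad a b c : ℝ) ^ (ε / 5)
    · have h := hC₂ a b c habc hcard hf hs
      have h5 : 5 * (ε / 5) = ε := by ring
      rw [h5] at h
      exact h.trans (mul_le_mul_of_nonneg_right hK2 hrε)
    · push Not at hs
      have hs' : ∀ p ∈ (a * b * c).primeFactors, p ≠ 2 → (rad a b c : ℝ) ^ (ε / 5) < p :=
        fun p hp hp2 => hs p hp hp2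
      have h := hC₃ a b c habc hcard hf hs'
      have hmono : (rad a b c : ℝ) ^ (ε / 5) ≤ (rad a b c : ℝ) ^ ε :=
        Real.rpow_le_rpow_of_exponent_le hrad1 (by linarith)
      calc ((∏ p ∈ (a * b * c).primeFactors, (a * b * c).factorization p : ℕ) : ℝ)
          ≤ C₃ * (rad a b c : ℝ) ^ (ε / 5) := h
        _ ≤ max C₃ 0 * (rad a b c : ℝ) ^ (ε / 5) :=
            mul_le_mul_of_nonneg_right (le_max_left _ _) (Real.rpow_nonneg (zero_le_one.trans hrad1) _)
        _ ≤ max C₃ 0 * (rad a b c : ℝ) ^ ε := mul_le_mul_of_nonneg_left hmono (le_max_right _ _)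
        _ ≤ max (max C₁ C₂) (max C₃ 0) * (rad a b c : ℝ) ^ ε :=
            mul_le_mul_of_nonneg_right (le_max_right _ _) hrε

end Summit.ABC.ABC.Theorems.FewPrimeValuationProduct

end
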